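import Literature.Geometry.Riemannian.PinchingEstimatesSingularMax
import Literature.Geometry.Riemannian.PinchingEstimates
import HarnessLib

/-!
# Hamilton 1997, Thm. 1.9 at the extremal vectors: the pointwise differential inequality
(topic `Geometry/Riemannian`)

Part of the decomposition of `Literature.Geometry.Riemannian.hamilton_chenZhu_pinching`
(`PinchingEstimates.lean`). Hamilton 1997, §2.1, Thm. 1.9 (pp. 12–13): under `a₁ + ρ > 0`,
`c₁ + ρ > 0`, `max(a₃, b₃, c₃) ≤ Ω(a₁ + ρ)`, `≤ Ω(c₁ + ρ)` (`Matrix.PinchedBy ρ Ω`), "for any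
constant `H > 0` the inequality `b₃ ≤ H e^{Pt} √((a₁ + ρ)(c₁ + ρ))` is preserved by the Ricci flow
with `P = 4Ωρ`. Proof. `d/dt ln b₃ ≤ a₃ + c₃ + 2b₁` … `d/dt ln(a₁ + ρ) ≥ 2a₃ + 2b₁ - 4Ωρ`.
Likewise `d/dt ln(c₁ + ρ) ≥ 2c₃ + 2b₁ - 4Ωρ` …"

In the tree's variational language (`HamiltonODE.SingularValueLEExp`) the preserved quantity is
the minimum over `((u, v), (w, z)) ∈ unitSet⁴` of
`G = H e^{Pt} √((wᵀAw + ρ)(zᵀCz + ρ)) - uᵀBv`; at a minimiser `(u, v)` maximises `uᵀBv` (`b₃`),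
`w` and `z` minimise the Rayleigh quotients of `A` and `C` (`a₁`, `c₁`). PROVED here, pointwise:

* `singular_upper` — `uᵀB'v ≤ Y (uᵀAu + vᵀCv + |ᵗBw| + |Bz|)` at the maximising pair
  (`Y = uᵀBv > 0`; Hamilton's `a₃b₃ + b₃c₃ + 2b₁b₂` with `b₁b₂ = |det B|/b₃ ≤ |ᵗBw| b₃`);
* `rayleighMin_lower` — `wᵀA'w ≥ 2 wᵀAw (M + |ᵗBw|)` at the minimising `w`, `M = max zᵀAz`
  (Hamilton's `a₁² + 2a₂a₃ + b₁² ≥ 2a₁(a₃ + b₁)`);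
* `singular_scalar` — the bookkeeping `G' ≥ S · G`, `S = Mᴬ + Mᶜ + |ᵗBw| + |Bz|`, for
  `P ≥ 4Ωρ`, from the two bounds and `Mᴬ, |ᵗBw| ≤ Ω(wᵀAw + ρ)`, `Mᶜ, |Bz| ≤ Ω(zᵀCz + ρ)`.

## References

* R. S. Hamilton, Comm. Anal. Geom. 5 (1997), §2.1, Thm. 1.9 and its proof (pp. 12–13). [Hamilton1997]
-/

noncomputable section

open Set Real
open scoped Matrix BigOperators

namespace Literature.Geometry.Riemannian

namespace HamiltonODE

variable {A B C : Matrix (Fin 3) (Fin 3) ℝ}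

/-- **`d b₃/dt ≤ (a₃ + c₃)b₃ + 2b₁b₂`, variationally**: at a maximising pair `(u, v)` of `uᵀBv`
with value `Y > 0`, for all unit `w, z`:
`uᵀ(AB + BC + 2B^#)v ≤ Y (uᵀAu + vᵀCv + |ᵗBw| + |Bz|)`. [cite: Hamilton1997, §2.1, Thm. 1.9 (proof, p. 12)] -/
theorem singular_upper {u v w z : Fin 3 → ℝ} (hu : u ⬝ᵥ u = 1) (hv : v ⬝ᵥ v = 1)
    (hw : w ⬝ᵥ w = 1) (hz : z ⬝ᵥ z = 1)
    (hmax : ∀ u' v' : Fin 3 → ℝ, u' ⬝ᵥ u' = 1 → v' ⬝ᵥ v' = 1 → u' ⬝ᵥ (B *ᵥ v') ≤ u ⬝ᵥ (B *ᵥ v))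
    (hY : 0 < u ⬝ᵥ (B *ᵥ v)) :
    u ⬝ᵥ ((A * B + B * C + (2 : ℝ) • B.sharp) *ᵥ v) ≤
      (u ⬝ᵥ (B *ᵥ v)) * (u ⬝ᵥ (A *ᵥ u) + v ⬝ᵥ (C *ᵥ v) + ((Bᵀ *ᵥ w) ⬝ᵥ (Bᵀ *ᵥ w)).sqrt +
        ((B *ᵥ z) ⬝ᵥ (B *ᵥ z)).sqrt) := by
  obtain ⟨hBv, hBu⟩ := bilinear_firstOrder hu hv hmax
  rw [bilinear_field_eq (A := A) (C := C) hBv hBu]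
  have hdet := adj_term_eq (B := B) hu hBu
  have h1 := abs_det_le_of_max hY.le (fun u' v' hu' hv' ↦ hmax u' v' hu' hv') hw
  have h2 := abs_det_le_of_max' hY.le (fun u' v' hu' hv' ↦ hmax u' v' hu' hv') hz
  have hd : B.det ≤ |B.det| := le_abs_self _
  -- `2 vᵀ(adj B)u = 2 det B / Y ≤ (|ᵗBw| + |Bz|) Y`
  have key : 2 * (u ⬝ᵥ (B *ᵥ v)) * (v ⬝ᵥ (B.adjugate *ᵥ u)) ≤
      (u ⬝ᵥ (B *ᵥ v)) ^ 2 * (((Bᵀ *ᵥ w) ⬝ᵥ (Bᵀ *ᵥ w)).sqrt + ((B *ᵥ z) ⬝ᵥ (B *ᵥ z)).sqrt) := by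
    nlinarith
  nlinarith [key]

/-- **`d(a₁ + ρ)/dt ≥ 2a₁(a₃ + b₁)`, variationally**: for symmetric `A` with `a₁ + a₂ ≥ m > 0`, at
a minimising unit `w` and with `M = u₃ᵀAu₃` the maximum of the Rayleigh quotient,
`wᵀ(A² + BᵗB + 2A^#)w ≥ 2 wᵀAw (M + |ᵗBw|)`. [cite: Hamilton1997, §2.1, Thm. 1.9 (proof, p. 12)] -/
theorem rayleighMin_lower (hA : A.IsSymm) {m : ℝ} (hm : 0 < m) (h12 : A.TwoSmallestEigenvaluesSumGE m)
    {w u₃ : Fin 3 → ℝ} (hw : w ⬝ᵥ w = 1) (hu₃ : u₃ ⬝ᵥ u₃ = 1)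
    (hmin : ∀ z ∈ unitSet, w ⬝ᵥ (A *ᵥ w) ≤ z ⬝ᵥ (A *ᵥ z))
    (hmax : ∀ z ∈ unitSet, z ⬝ᵥ (A *ᵥ z) ≤ u₃ ⬝ᵥ (A *ᵥ u₃)) :
    2 * (w ⬝ᵥ (A *ᵥ w)) * (u₃ ⬝ᵥ (A *ᵥ u₃) + ((Bᵀ *ᵥ w) ⬝ᵥ (Bᵀ *ᵥ w)).sqrt) ≤
      w ⬝ᵥ ((A * A + B * Bᵀ + (2 : ℝ) • A.sharp) *ᵥ w) := by
  obtain ⟨y, y', hy, hy', hwy, hwy', hyy', cwy, cwy', cyy', hdd⟩ :=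
    exists_diag_basis_of_min hA hm h12 hw hu₃ hmin hmax
  have cyw : y ⬝ᵥ (A *ᵥ w) = 0 := by rw [quad_comm_of_isSymm hA]; exact cwy
  have cy'w : y' ⬝ᵥ (A *ᵥ w) = 0 := by rw [quad_comm_of_isSymm hA]; exact cwy'
  rw [quad_field_eq_of_diag (N := B) hA hy hy' hw hyy' (by rw [dotProduct_comm]; exact hwy)
    (by rw [dotProduct_comm]; exact hwy') cyy' cyw cy'w]
  have hq0 : 0 ≤ (Bᵀ *ᵥ w) ⬝ᵥ (Bᵀ *ᵥ w) := Finset.sum_nonneg fun i _ ↦ mul_self_nonneg _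
  have hsq := Real.sq_sqrt hq0
  nlinarith [sq_nonneg (w ⬝ᵥ (A *ᵥ w) - ((Bᵀ *ᵥ w) ⬝ᵥ (Bᵀ *ᵥ w)).sqrt)]

/-- **The scalar bookkeeping of Hamilton's proof of Thm. 1.9** (p. 13), multiplied out. With
`X = x + ρ > 0`, `Z = ζ + ρ > 0`, `F = √(XZ)`, `Y > 0`, `E = H e^{Pt} > 0`, `G = EF - Y`, and the
bounds `Y' ≤ Y(Mᴬ + Mᶜ + β + β')`, `X' ≥ 2x(Mᴬ + β)`, `Z' ≥ 2ζ(Mᶜ + β')`,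
`Mᴬ, β ≤ ΩX`, `Mᶜ, β' ≤ ΩZ`, `ρ > 0`, `4Ωρ ≤ P`:
`S · G ≤ E P F + E (X'Z + XZ')/(2F) - Y'` for `S = Mᴬ + Mᶜ + β + β'`.
[cite: Hamilton1997, §2.1, Thm. 1.9 (proof, p. 13)] -/
theorem singular_scalar {x ζ ρ Ω P E F Y Y' X' Z' MA MC β β' : ℝ} (hρ : 0 < ρ)
    (hP : 4 * Ω * ρ ≤ P) (hE : 0 < E) (hX : 0 < x + ρ) (hZ : 0 < ζ + ρ)
    (hF : F ^ 2 = (x + ρ) * (ζ + ρ)) (hF0 : 0 < F)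
    (hY' : Y' ≤ Y * (MA + MC + β + β')) (hX' : 2 * x * (MA + β) ≤ X') (hZ' : 2 * ζ * (MC + β') ≤ Z')
    (hMA : MA ≤ Ω * (x + ρ)) (hβ : β ≤ Ω * (x + ρ)) (hMC : MC ≤ Ω * (ζ + ρ)) (hβ' : β' ≤ Ω * (ζ + ρ)) :
    (MA + MC + β + β') * (E * F - Y) ≤ E * P * F + E * ((X' * (ζ + ρ) + (x + ρ) * Z') / (2 * F)) - Y' := by
  -- `X' ≥ (2(MA + β) - 4Ωρ) X`, `Z' ≥ (2(MC + β') - 4Ωρ) Z`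
  have hX'' : (2 * (MA + β) - 4 * Ω * ρ) * (x + ρ) ≤ X' := by nlinarith
  have hZ'' : (2 * (MC + β') - 4 * Ω * ρ) * (ζ + ρ) ≤ Z' := by nlinarith
  -- hence `X'Z + XZ' ≥ (2S - 8Ωρ) F²`
  have hsum : (2 * (MA + MC + β + β') - 8 * Ω * ρ) * F ^ 2 ≤ X' * (ζ + ρ) + (x + ρ) * Z' := by
    rw [hF]; nlinarith [mul_le_mul_of_nonneg_right hX'' hZ.le, mul_le_mul_of_nonneg_left hZ'' hX.le]
  have hdiv : (MA + MC + β + β' - 4 * Ω * ρ) * F ≤ (X' * (ζ + ρ) + (x + ρ) * Z') / (2 * F) := by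
    rw [le_div_iff₀ (by linarith)]; nlinarith
  have h1 : E * ((MA + MC + β + β' - 4 * Ω * ρ) * F) ≤ E * ((X' * (ζ + ρ) + (x + ρ) * Z') / (2 * F)) :=
    mul_le_mul_of_nonneg_left hdiv hE.le
  have h2 : 0 ≤ E * F * (P - 4 * Ω * ρ) := mul_nonneg (mul_pos hE hF0).le (by linarith)
  nlinarith

end HamiltonODE

end Literature.Geometry.Riemannian

end
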